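import Summits.AtomisticToContinuum.HydrodynamicLimit.Theorems.LambertianContactSwapSwapGapRelEntBudget
import HarnessLib

/-!
# `SwapGap` (stmt-AtomisticToContinuum-11850), line `Sketch`: the exact split of S1 — `RelEntSwap ⟸ Λ-Liouville invariance ∧ Λ-adiabaticity ∧ likelihood gap`

Helper file (`--supports`) for the crux
`Summit.AtomisticToContinuum.HydrodynamicLimit.Theses.LambertianContactSwap.SwapGap`, line `Sketch`,
registered stub S1 `stub_relEntSwap` (`KL(p_t ‖ q_t)/(N+1) → 0` pre-shock, `p_t = (Φ_t)_* P_N`,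
`q_t = (Λ_t)_* (P_N ⊗ γ^ℕ)`).  By the exact decomposition
`KL(p_t ‖ q_t) = [KL(P_N ‖ G_N) - KL(q_t ‖ G_N)] + [∫ h_t dq_t - ∫ h_t dp_t]`, `h_t = llr q_t G_N`,
`G_N = localGibbsLaw σ 1 0 1 N (Φ N)` (`…SwapGapRelEntBudget.klDiv_map_flow_map_lambertFlow_decomposition`,
modulo the `Λ`-invariance of `liouville ⊗ γ^ℕ` = crux 11854's `stub_liouvilleInvariance`), S1 is the
conjunction of two statements with the crux's own quantifier prefix:

* S1a, Λ-ADIABATICITY PRE-SHOCK — `[KL(P_N ‖ G_N) - KL(q_t ‖ G_N)]/(N+1) → 0`: the Lambertian gas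
  started from local Gibbs data produces no entropy at the macroscopic scale before the first shock
  (a statement about `Λ` ALONE, termwise `≥ 0` by data processing; it is entropy-form
  `LambertianEuler` plus the isentropy of smooth Euler flow);
* S1b, LIKELIHOOD GAP — `[∫ h_t dq_t - ∫ h_t dp_t]/(N+1) → 0`: the deterministic law assigns the
  Lambertian log-likelihood `h_t` (an `O(N)` macroscopic functional, `|h_t| ≤ A(N+1) + bE`) the same
  specific value as the Lambertian law itself — the irreducible comparison content of the crux.

`relEntSwap_of_adiabaticity_of_likelihoodGap : S0 → S1a → S1b → S1` is the glue (the reshape of the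
line's skeleton registers S0, S1a, S1b as stubs in place of S1).  [folklore] bookkeeping over the
decomposition; prover-line-stmt-AtomisticToContinuum-11850-c1-0 (line lead c1), cycle 2 of the line.
-/

noncomputable section

open MeasureTheory Filter Set Topology InformationTheory
open scoped ENNReal

namespace Summit.AtomisticToContinuum.HydrodynamicLimit.Theorems.LambertianContactSwapSwapGapRelEntSwapSplit

open Literature.Analysis.FluidPDE Literature.MathematicalPhysics.KineticTheory
open Summit.AtomisticToContinuum.HydrodynamicLimit.Theorems
open Summit.AtomisticToContinuum.HydrodynamicLimit.Theorems.LambertianContactSwapSwapGapRelEntBudget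

/-- **The exact split of S1 (`stub_relEntSwap`)**: granted the `Λ`-invariance of `liouville ⊗ γ^ℕ`
(S0, crux 11854's `stub_liouvilleInvariance`), S1 — `KL(p_t ‖ q_t)/(N+1) → 0` pre-shock — follows
from (and, by `klDiv_map_flow_map_lambertFlow_decomposition`, is equivalent to the conjunction of)
* S1a, Λ-ADIABATICITY PRE-SHOCK: `[KL(P_N ‖ G_N) - KL(q_t ‖ G_N)]/(N+1) → 0` (the Lambertian gas
  started from local Gibbs data produces no entropy at the macroscopic scale before the first shock;
  a statement about `Λ` alone, `≥ 0` termwise by data processing), and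
* S1b, LIKELIHOOD GAP: `[∫ h_t dq_t - ∫ h_t dp_t]/(N+1) → 0`, `h_t = llr q_t G_N` (the deterministic
  law assigns the Lambertian log-likelihood the same specific value as the Lambertian law itself —
  the irreducible comparison content of the crux),
with the same quantifier prefix as the crux (`G_N = localGibbsLaw σ 1 0 1 N (Φ N)` the standard
homogeneous Gibbs law; S1a and S1b carry their finiteness / integrability clauses, which are theorems
modulo S0).  Proof: for `σ < min (1/2, σ₁, σ₂)` and `t ∈ [0, T)` the decomposition gives
`KL(p_t ‖ q_t) = (N+1)·(a_N + b_N)` in `ℝ` with `a_N, b_N → 0` the two bracketed sequences, and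
`KL(p_t ‖ q_t) < ∞` converts the real limit into the `ℝ≥0∞` one. [folklore] -/
theorem relEntSwap_of_adiabaticity_of_likelihoodGap
    (hLI : ∀ ε : ℝ, 0 < ε → ε < 2⁻¹ → ∀ (N : ℕ) (t : ℝ), 0 ≤ t →
      ((liouville (Torus.geometry (Fin 3)) N ε).prod (lambertNoise (Fin 3))).map
          (fun p => lambertFlow (Torus.geometry (Fin 3)) ε p.2 p.1 t) =
        liouville (Torus.geometry (Fin 3)) N ε)
    (h1a : ∀ (a₀ θ₀ : T3 → ℝ) (u₀ : T3 → V3), Continuous a₀ → Continuous θ₀ → Continuous u₀ →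
      (∀ x, 0 < a₀ x) → (∀ x, 0 < θ₀ x) →
      ∃ σ₀ : ℝ, 0 < σ₀ ∧ ∀ σ : ℝ, 0 < σ → σ < σ₀ →
        ∀ (T : ℝ) (ρ θ : ℝ → T3 → ℝ) (u : ℝ → T3 → V3), IsHardSphereEulerSolution σ T ρ u θ →
          ∀ Φ : (N : ℕ) → HardSphereFlow (Torus.geometry (Fin 3)) (hsDiameter σ N) (N + 1),
            TendstoHydroFieldsAt (fun N => localGibbsLaw σ a₀ u₀ θ₀ N (Φ N)) Φ ρ u θ 0 →
              ∀ t ∈ Set.Ico 0 T,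
                (∀ N : ℕ, klDiv (((localGibbsLaw σ a₀ u₀ θ₀ N (Φ N)).prod (lambertNoise (Fin 3))).map
                    (fun p => lambertFlow (Torus.geometry (Fin 3)) (hsDiameter σ N) p.2 p.1 t))
                  (localGibbsLaw σ (fun _ => 1) (fun _ => 0) (fun _ => 1) N (Φ N)) ≠ ∞) ∧
                Tendsto (fun N : ℕ =>
                  ((klDiv (localGibbsLaw σ a₀ u₀ θ₀ N (Φ N))
                      (localGibbsLaw σ (fun _ => 1) (fun _ => 0) (fun _ => 1) N (Φ N))).toReal -
                    (klDiv (((localGibbsLaw σ a₀ u₀ θ₀ N (Φ N)).prod (lambertNoise (Fin 3))).map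
                        (fun p => lambertFlow (Torus.geometry (Fin 3)) (hsDiameter σ N) p.2 p.1 t))
                      (localGibbsLaw σ (fun _ => 1) (fun _ => 0) (fun _ => 1) N (Φ N))).toReal) /
                  ((N : ℝ) + 1)) atTop (𝓝 0))
    (h1b : ∀ (a₀ θ₀ : T3 → ℝ) (u₀ : T3 → V3), Continuous a₀ → Continuous θ₀ → Continuous u₀ →
      (∀ x, 0 < a₀ x) → (∀ x, 0 < θ₀ x) →
      ∃ σ₀ : ℝ, 0 < σ₀ ∧ ∀ σ : ℝ, 0 < σ → σ < σ₀ →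
        ∀ (T : ℝ) (ρ θ : ℝ → T3 → ℝ) (u : ℝ → T3 → V3), IsHardSphereEulerSolution σ T ρ u θ →
          ∀ Φ : (N : ℕ) → HardSphereFlow (Torus.geometry (Fin 3)) (hsDiameter σ N) (N + 1),
            TendstoHydroFieldsAt (fun N => localGibbsLaw σ a₀ u₀ θ₀ N (Φ N)) Φ ρ u θ 0 →
              ∀ t ∈ Set.Ico 0 T,
                (∀ N : ℕ,
                  Integrable (llr (((localGibbsLaw σ a₀ u₀ θ₀ N (Φ N)).prod (lambertNoise (Fin 3))).map
                      (fun p => lambertFlow (Torus.geometry (Fin 3)) (hsDiameter σ N) p.2 p.1 t))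
                    (localGibbsLaw σ (fun _ => 1) (fun _ => 0) (fun _ => 1) N (Φ N)))
                    ((localGibbsLaw σ a₀ u₀ θ₀ N (Φ N)).map ((Φ N).flow t)) ∧
                  Integrable (llr (((localGibbsLaw σ a₀ u₀ θ₀ N (Φ N)).prod (lambertNoise (Fin 3))).map
                      (fun p => lambertFlow (Torus.geometry (Fin 3)) (hsDiameter σ N) p.2 p.1 t))
                    (localGibbsLaw σ (fun _ => 1) (fun _ => 0) (fun _ => 1) N (Φ N)))
                    (((localGibbsLaw σ a₀ u₀ θ₀ N (Φ N)).prod (lambertNoise (Fin 3))).map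
                      (fun p => lambertFlow (Torus.geometry (Fin 3)) (hsDiameter σ N) p.2 p.1 t))) ∧
                Tendsto (fun N : ℕ =>
                  ((∫ z, llr (((localGibbsLaw σ a₀ u₀ θ₀ N (Φ N)).prod (lambertNoise (Fin 3))).map
                        (fun p => lambertFlow (Torus.geometry (Fin 3)) (hsDiameter σ N) p.2 p.1 t))
                      (localGibbsLaw σ (fun _ => 1) (fun _ => 0) (fun _ => 1) N (Φ N)) z
                      ∂(((localGibbsLaw σ a₀ u₀ θ₀ N (Φ N)).prod (lambertNoise (Fin 3))).map
                        (fun p => lambertFlow (Torus.geometry (Fin 3)) (hsDiameter σ N) p.2 p.1 t))) -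
                    ∫ z, llr (((localGibbsLaw σ a₀ u₀ θ₀ N (Φ N)).prod (lambertNoise (Fin 3))).map
                        (fun p => lambertFlow (Torus.geometry (Fin 3)) (hsDiameter σ N) p.2 p.1 t))
                      (localGibbsLaw σ (fun _ => 1) (fun _ => 0) (fun _ => 1) N (Φ N)) z
                      ∂((localGibbsLaw σ a₀ u₀ θ₀ N (Φ N)).map ((Φ N).flow t))) /
                  ((N : ℝ) + 1)) atTop (𝓝 0)) :
    ∀ (a₀ θ₀ : T3 → ℝ) (u₀ : T3 → V3), Continuous a₀ → Continuous θ₀ → Continuous u₀ →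
      (∀ x, 0 < a₀ x) → (∀ x, 0 < θ₀ x) →
      ∃ σ₀ : ℝ, 0 < σ₀ ∧ ∀ σ : ℝ, 0 < σ → σ < σ₀ →
        ∀ (T : ℝ) (ρ θ : ℝ → T3 → ℝ) (u : ℝ → T3 → V3), IsHardSphereEulerSolution σ T ρ u θ →
          ∀ Φ : (N : ℕ) → HardSphereFlow (Torus.geometry (Fin 3)) (hsDiameter σ N) (N + 1),
            TendstoHydroFieldsAt (fun N => localGibbsLaw σ a₀ u₀ θ₀ N (Φ N)) Φ ρ u θ 0 →
              ∀ t ∈ Set.Ico 0 T,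
                Tendsto (fun N : ℕ =>
                  klDiv ((localGibbsLaw σ a₀ u₀ θ₀ N (Φ N)).map ((Φ N).flow t))
                    (((localGibbsLaw σ a₀ u₀ θ₀ N (Φ N)).prod (lambertNoise (Fin 3))).map
                      (fun p => lambertFlow (Torus.geometry (Fin 3)) (hsDiameter σ N) p.2 p.1 t)) /
                  ((N : ℝ≥0∞) + 1)) atTop (𝓝 0) := by
  intro a₀ θ₀ u₀ ha hθ hu ha0 hθ0
  obtain ⟨σ₁, hσ₁, h1a'⟩ := h1a a₀ θ₀ u₀ ha hθ hu ha0 hθ0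
  obtain ⟨σ₂, hσ₂, h1b'⟩ := h1b a₀ θ₀ u₀ ha hθ hu ha0 hθ0
  refine ⟨min 2⁻¹ (min σ₁ σ₂), lt_min (by norm_num) (lt_min hσ₁ hσ₂), ?_⟩
  intro σ hσ hσlt T ρ θ u hE Φ h0 t ht
  have hσhalf : σ < 2⁻¹ := hσlt.trans_le (min_le_left _ _)
  have hσ₁' : σ < σ₁ := hσlt.trans_le ((min_le_right _ _).trans (min_le_left _ _))
  have hσ₂' : σ < σ₂ := hσlt.trans_le ((min_le_right _ _).trans (min_le_right _ _))
  obtain ⟨-, ha_lim⟩ := h1a' σ hσ hσ₁' T ρ θ u hE Φ h0 t ht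
  obtain ⟨-, hb_lim⟩ := h1b' σ hσ hσ₂' T ρ θ u hE Φ h0 t ht
  obtain ⟨A, b, hA, hb, hdec⟩ :=
    klDiv_map_flow_map_lambertFlow_decomposition hLI ha hθ hu ha0 hθ0 hσ hσhalf
  -- the real sequence `KL(p_t ‖ q_t).toReal / (N+1)` is the sum of the two bracketed sequences
  have hsum := ha_lim.add hb_lim
  rw [add_zero] at hsum
  have hreal : Tendsto (fun N : ℕ =>
      (klDiv ((localGibbsLaw σ a₀ u₀ θ₀ N (Φ N)).map ((Φ N).flow t))
        (((localGibbsLaw σ a₀ u₀ θ₀ N (Φ N)).prod (lambertNoise (Fin 3))).map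
          (fun p => lambertFlow (Torus.geometry (Fin 3)) (hsDiameter σ N) p.2 p.1 t))).toReal /
      ((N : ℝ) + 1)) atTop (𝓝 0) := by
    refine hsum.congr fun N => ?_
    obtain ⟨-, -, -, -, heq, heqν, -, -⟩ := hdec N (Φ N) t ht.1
    rw [heq, heqν]
    ring
  -- back to `ℝ≥0∞`
  have hfinN : ∀ N : ℕ, klDiv ((localGibbsLaw σ a₀ u₀ θ₀ N (Φ N)).map ((Φ N).flow t))
      (((localGibbsLaw σ a₀ u₀ θ₀ N (Φ N)).prod (lambertNoise (Fin 3))).map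
        (fun p => lambertFlow (Torus.geometry (Fin 3)) (hsDiameter σ N) p.2 p.1 t)) ≠ ∞ :=
    fun N => (hdec N (Φ N) t ht.1).1
  have h := ENNReal.tendsto_ofReal hreal
  rw [ENNReal.ofReal_zero] at h
  refine h.congr fun N => ?_
  have hN : (0 : ℝ) < (N : ℝ) + 1 := by positivity
  rw [ENNReal.ofReal_div_of_pos hN, ENNReal.ofReal_toReal (hfinN N)]
  congr 1
  rw [ENNReal.ofReal_add (by positivity) zero_le_one, ENNReal.ofReal_natCast, ENNReal.ofReal_one]

end Summit.AtomisticToContinuum.HydrodynamicLimit.Theorems.LambertianContactSwapSwapGapRelEntSwapSplit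

end
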